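import Mathlib.Topology.Algebra.Category.ProfiniteGrp.Completion
import Mathlib.Topology.Algebra.Category.ProfiniteGrp.Limits
import Mathlib.GroupTheory.FreeGroup.Basic
import Mathlib.Logic.Small.Defs
import Literature.AnabelianGeometry.SemiGraphs.TemperedCurves
import Literature.AnabelianGeometry.EtaleTheta.SettingFreeProfiniteWitness
import Literature.AnabelianGeometry.EtaleTheta.SettingFreeProfiniteTransport
import HarnessLib

/-!
# Free profinite groups are unique: `IsFreeProfiniteOn P x ⇒ P ≃ₜ* F̂(ι)` (proof-only)

Mochizuki, *The étale theta function …* [EtTh], §1, PRIMS p. 12 (printed 238): "`Δ_X` is a profinite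
free group on 2 generators" [cite: MochizukiEtTh2009, §1 p.12]; the cell records this hypothesis as the
universal property `Literature.AnabelianGeometry.SemiGraphs.IsFreeProfiniteOn P x` (unique continuous
extension of every map of the generators into a FINITE DISCRETE group; `TemperedCurves.lean`,
abc-iut-L3-t2).  The L3/L5 merge of [IUTchI] Prop. 2.4 (i) (`ProfiniteCompletionFreeAbelianTorsionFree`,
abc-iut-w4-d055: "modulo the identification `Δ̂_X ≃ₜ* Ĝ`") needs the classical UNIQUENESS of free
profinite groups (Ribes–Zalesskii, *Profinite Groups*, Prop. 3.3.2 / Lemma 3.3.4): a profinite group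
with that universal property IS, as a topological group, the profinite completion `F̂(ι)` of the free
group (Mathlib `ProfiniteGrp.ProfiniteCompletion.completion`), compatibly with the generators.

PROOF-ONLY file (abc-iut cell, seat abc-iut-w5-d106; no definition, no named fact):
* `IsFreeProfiniteOn.continuousMonoidHom_ext` — two continuous homomorphisms from `P` to a PROFINITE
  group agreeing on the family `x` coincide (the uniqueness clause at every finite discrete quotient
  `Q ⧸ U`, `U` open normal, and `Q ↪ lim Q/U`, Mathlib `ProfiniteGrp.toLimit_injective`);
* `IsFreeProfiniteOn.exists_continuousMonoidHom_completion` — the comparison map `P → F̂(ι)`,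
  `x i ↦ η (of i)` (the compatible family of the unique coordinate maps `P → F ⧸ N`);
* `IsFreeProfiniteOn.exists_continuousMulEquiv_completion` — **`P ≃ₜ* F̂(ι)` with `x i ↦ η (of i)`**
  (inverse: the universal arrow `ProfiniteCompletion.lift (FreeGroup.lift x)`; the two composites are
  identities by the two uniqueness statements);
* `IsFreeProfiniteOn.exists_continuousMulEquiv_completion_shrink` / `…_ulift` — the same for generators
  indexed in another universe (`FreeGroup (Shrink ι)` for `ι` small, `FreeGroup (ULift ι)` for
  `ι : Type`, e.g. `ι = Fin 2` with `P : Type u`);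
* `IsFreeProfiniteOn.exists_continuousMulEquiv` — any two free profinite groups on `ι`-indexed families
  are isomorphic compatibly with the families.
HONEST FRAMING: classical, undisputed profinite group theory; nothing of [EtTh]/[IUTchI] is asserted;
nothing here bears on [IUTchIII] Cor. 3.12.
-/

noncomputable section

open CategoryTheory Topology ProfiniteGrp ProfiniteGrp.ProfiniteCompletion

universe u v

namespace Literature.AnabelianGeometry.SemiGraphs

variable {ι : Type u} {P : Type u} [Group P] [TopologicalSpace P] {x : ι → P}

/-! ### Uniqueness of continuous homomorphisms out of a free profinite group -/

/-- **Continuous homomorphisms out of a free profinite group are determined by the generators** (into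
any profinite target): if `g₁ g₂ : P →ₜ* Q`, `Q` profinite, agree on the family `x`, then `g₁ = g₂` —
the uniqueness clause of `IsFreeProfiniteOn` applied to the finite discrete quotients `Q ⧸ U` (`U` open
normal), which separate the points of `Q`. (Ribes–Zalesskii, *Profinite Groups*, §3.3.)
[cite: MochizukiEtTh2009, §1 p.12] -/
theorem IsFreeProfiniteOn.continuousMonoidHom_ext (h : IsFreeProfiniteOn P x) {Q : Type u} [Group Q]
    [TopologicalSpace Q] [IsTopologicalGroup Q] [CompactSpace Q] [T2Space Q]
    [TotallyDisconnectedSpace Q] {g₁ g₂ : P →ₜ* Q} (hg : ∀ i, g₁ (x i) = g₂ (x i)) : g₁ = g₂ := by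
  refine ContinuousMonoidHom.ext fun p => ?_
  -- test against every open normal subgroup `U` of `Q`
  have key : ∀ U : OpenNormalSubgroup (ProfiniteGrp.of Q),
      (QuotientGroup.mk (g₁ p) : Q ⧸ U.toSubgroup) = QuotientGroup.mk (g₂ p) := by
    intro U
    haveI : DiscreteTopology (Q ⧸ U.toSubgroup) := QuotientGroup.discreteTopology U.isOpen'
    let π : Q →ₜ* Q ⧸ U.toSubgroup := ⟨QuotientGroup.mk' U.toSubgroup, QuotientGroup.continuous_mk⟩
    obtain ⟨f, -, huniq⟩ := h (Q ⧸ U.toSubgroup) (fun i => QuotientGroup.mk (g₁ (x i)))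
    have h₁ : π.comp g₁ = f := huniq _ fun i => rfl
    have h₂ : π.comp g₂ = f := huniq _ fun i => by
      change QuotientGroup.mk (g₂ (x i)) = QuotientGroup.mk (g₁ (x i))
      rw [hg i]
    have := congrArg (fun φ : P →ₜ* Q ⧸ U.toSubgroup => φ p) (h₁.trans h₂.symm)
    exact this
  -- the quotients separate points
  have hinj := ProfiniteGrp.toLimit_injective (ProfiniteGrp.of Q)
  have : ProfiniteGrp.toLimit (ProfiniteGrp.of Q) (g₁ p) = ProfiniteGrp.toLimit (ProfiniteGrp.of Q) (g₂ p) :=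
    Subtype.ext (funext fun U => key U)
  exact hinj this

/-! ### The comparison map `P → F̂(ι)` -/

/-- **The comparison map**: a free profinite group on `x` maps continuously to the profinite completion
`F̂(ι)` of the free group with `x i ↦ η (of i)` — the compatible family of the unique continuous
homomorphisms `P → F(ι) ⧸ N` (`N` of finite index, the quotient discrete) sending `x i` to the class of
`of i`. (Ribes–Zalesskii, *Profinite Groups*, §3.3.) [cite: MochizukiEtTh2009, §1 p.12] -/
theorem IsFreeProfiniteOn.exists_continuousMonoidHom_completion (h : IsFreeProfiniteOn P x) :
    ∃ f : P →ₜ* completion (GrpCat.of (FreeGroup ι)),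
      ∀ i, f (x i) = etaFn (GrpCat.of (FreeGroup ι)) (FreeGroup.of i) := by
  classical
  let G : GrpCat.{u} := GrpCat.of (FreeGroup ι)
  -- the coordinate maps, with their uniqueness, for the discrete topology on the finite quotients
  have hN : ∀ N : FiniteIndexNormalSubgroup G, ∃ φ : P →* (G ⧸ N.toSubgroup),
      (∀ i, φ (x i) = QuotientGroup.mk (FreeGroup.of i)) ∧
      @Continuous P (G ⧸ N.toSubgroup) _ ⊥ φ ∧
      ∀ ψ : P →* (G ⧸ N.toSubgroup), @Continuous P (G ⧸ N.toSubgroup) _ ⊥ ψ →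
        (∀ i, ψ (x i) = QuotientGroup.mk (FreeGroup.of i)) → ψ = φ := by
    intro N
    letI : TopologicalSpace (G ⧸ N.toSubgroup) := ⊥
    haveI : DiscreteTopology (G ⧸ N.toSubgroup) := ⟨rfl⟩
    obtain ⟨φ, hφ, huniq⟩ :=
      h (G ⧸ N.toSubgroup) (fun i => (QuotientGroup.mk (FreeGroup.of i) : G ⧸ N.toSubgroup))
    refine ⟨φ.toMonoidHom, hφ, φ.continuous, fun ψ hψc hψ => ?_⟩
    have := huniq ⟨ψ, hψc⟩ hψ
    exact congrArg ContinuousMonoidHom.toMonoidHom this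
  choose φ hφx hφc hφu using hN
  -- compatibility along `N ≤ M`
  have hcompat : ∀ {N M : FiniteIndexNormalSubgroup G} (π : N ⟶ M) (p : P),
      (diagram G).map π (φ N p) = φ M p := by
    intro N M π p
    let q : (G ⧸ N.toSubgroup) →* (G ⧸ M.toSubgroup) :=
      QuotientGroup.map N.toSubgroup M.toSubgroup (MonoidHom.id _) π.le
    have hq : ∀ y, (diagram G).map π y = q y := fun y => rfl
    have hqc : @Continuous (G ⧸ N.toSubgroup) (G ⧸ M.toSubgroup) ⊥ ⊥ q := by
      letI : TopologicalSpace (G ⧸ N.toSubgroup) := ⊥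
      haveI : DiscreteTopology (G ⧸ N.toSubgroup) := ⟨rfl⟩
      letI : TopologicalSpace (G ⧸ M.toSubgroup) := ⊥
      exact continuous_of_discreteTopology
    have hψ : q.comp (φ N) = φ M := by
      refine hφu M (q.comp (φ N)) ?_ fun i => ?_
      · exact @Continuous.comp P (G ⧸ N.toSubgroup) (G ⧸ M.toSubgroup) _ ⊥ ⊥ _ _ hqc (hφc N)
      · change q (φ N (x i)) = _
        rw [hφx N i]
        rfl
    rw [hq, ← hψ]
    rfl
  -- the map into the limit
  let f₀ : P →* completion G :=
    { toFun := fun p => ⟨fun N => φ N p, fun N M π => hcompat π p⟩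
      map_one' := Subtype.ext (funext fun N => by
        change φ N 1 = 1
        exact map_one (φ N))
      map_mul' := fun p p' => Subtype.ext (funext fun N => by
        change φ N (p * p') = φ N p * φ N p'
        exact map_mul (φ N) p p') }
  have hf₀ : Continuous f₀ := by
    apply continuous_induced_rng.mpr
    apply continuous_pi
    intro N
    exact hφc N
  refine ⟨⟨f₀, hf₀⟩, fun i => Subtype.ext (funext fun N => ?_)⟩
  change φ N (x i) = QuotientGroup.mk (FreeGroup.of i)
  exact hφx N i

/-! ### The isomorphism `P ≃ₜ* F̂(ι)` -/

/-- **Uniqueness of free profinite groups**: a profinite group `P` that is free profinite on the family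
`x : ι → P` (in the sense of `IsFreeProfiniteOn`: unique continuous extension to every finite discrete
group) is isomorphic, AS A TOPOLOGICAL GROUP and compatibly with the generators, to the profinite
completion `F̂(ι)` of the free group on `ι` (Mathlib `ProfiniteGrp.ProfiniteCompletion.completion`):
`∃ e : P ≃ₜ* F̂(ι), e (x i) = η (of i)`.  The inverse is the universal arrow
`ProfiniteCompletion.lift (FreeGroup.lift x)`; `lift ∘ f = id` by `continuousMonoidHom_ext`,
`f ∘ lift = id` by `ProfiniteCompletion.lift_unique` and `FreeGroup.ext_hom`.
(Ribes–Zalesskii, *Profinite Groups*, Prop. 3.3.2.) [cite: MochizukiEtTh2009, §1 p.12] -/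
theorem IsFreeProfiniteOn.exists_continuousMulEquiv_completion [IsTopologicalGroup P] [CompactSpace P]
    [T2Space P] [TotallyDisconnectedSpace P] (h : IsFreeProfiniteOn P x) :
    ∃ e : P ≃ₜ* completion (GrpCat.of (FreeGroup ι)),
      ∀ i, e (x i) = etaFn (GrpCat.of (FreeGroup ι)) (FreeGroup.of i) := by
  classical
  let G : GrpCat.{u} := GrpCat.of (FreeGroup ι)
  obtain ⟨f, hf⟩ := h.exists_continuousMonoidHom_completion
  -- the inverse: the universal arrow of the profinite completion applied to `FreeGroup.lift x`
  let PP : ProfiniteGrp.{u} := ProfiniteGrp.of P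
  let ℓ : G ⟶ GrpCat.of PP := GrpCat.ofHom (FreeGroup.lift x)
  let g : completion G →ₜ* P := (lift ℓ).hom
  have hgη : ∀ y : FreeGroup ι, g (etaFn G y) = FreeGroup.lift x y := fun y => by
    have := lift_eta ℓ
    exact ConcreteCategory.congr_hom (C := GrpCat) this y
  have hgx : ∀ i, g (etaFn G (FreeGroup.of i)) = x i := fun i => by
    rw [hgη, FreeGroup.lift_apply_of]
  -- `g ∘ f = id`
  have hgf : g.comp f = ContinuousMonoidHom.id P :=
    h.continuousMonoidHom_ext (Q := P) fun i => by
      change g (f (x i)) = x i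
      rw [hf i, hgx i]
  -- `f ∘ g = id`
  have hfg : (lift ℓ) ≫ ProfiniteGrp.ofHom f = 𝟙 (completion G) := by
    apply lift_unique
    apply GrpCat.hom_ext
    apply FreeGroup.ext_hom
    intro i
    change f (g (etaFn G (FreeGroup.of i))) = etaFn G (FreeGroup.of i)
    rw [hgx i, hf i]
  have hfg' : ∀ y : completion G, f (g y) = y := fun y => by
    have := ConcreteCategory.congr_hom (C := ProfiniteGrp) hfg y
    exact this
  have hgf' : ∀ p : P, g (f p) = p := fun p => by
    have := congrArg (fun φ : P →ₜ* P => φ p) hgf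
    exact this
  let e₀ : P ≃* completion G :=
    { toFun := f
      invFun := g
      left_inv := hgf'
      right_inv := hfg'
      map_mul' := map_mul f }
  exact ⟨{ e₀ with continuous_toFun := f.continuous, continuous_invFun := g.continuous }, hf⟩

/-- **Uniqueness of free profinite groups, generators indexed in any (small) universe**: for
`x : ι → P` with `ι : Type v` `u`-small (e.g. finite or countable), `P : Type u` profinite and free
profinite on `x`, there is `e : P ≃ₜ* F̂(Shrink ι)` with `e (x i) = η (of (equivShrink ι i))` (reindex
along `equivShrink` by `IsFreeProfiniteOn.comp_equiv`, then `exists_continuousMulEquiv_completion`).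
[cite: MochizukiEtTh2009, §1 p.12] -/
theorem IsFreeProfiniteOn.exists_continuousMulEquiv_completion_shrink [IsTopologicalGroup P]
    [CompactSpace P] [T2Space P] [TotallyDisconnectedSpace P] {ι : Type v} [Small.{u} ι] {x : ι → P}
    (h : IsFreeProfiniteOn P x) :
    ∃ e : P ≃ₜ* completion (GrpCat.of (FreeGroup (Shrink.{u} ι))),
      ∀ i, e (x i) = etaFn (GrpCat.of (FreeGroup (Shrink.{u} ι))) (FreeGroup.of (equivShrink ι i)) := by
  have h' : IsFreeProfiniteOn P (x ∘ (equivShrink ι).symm) := h.comp_equiv (equivShrink ι).symm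
  obtain ⟨e, he⟩ := h'.exists_continuousMulEquiv_completion
  refine ⟨e, fun i => ?_⟩
  have := he (equivShrink ι i)
  rw [Function.comp_apply, Equiv.symm_apply_apply] at this
  exact this

/-- **The case of generators indexed in `Type`** (e.g. `ι = Fin 2`, the "profinite free group on 2
generators" of [EtTh] p. 12, with `P` in an arbitrary universe): `e : P ≃ₜ* F̂(ULift ι)` with
`e (x i) = η (of (up i))`. [cite: MochizukiEtTh2009, §1 p.12] -/
theorem IsFreeProfiniteOn.exists_continuousMulEquiv_completion_ulift [IsTopologicalGroup P]
    [CompactSpace P] [T2Space P] [TotallyDisconnectedSpace P] {ι : Type} {x : ι → P}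
    (h : IsFreeProfiniteOn P x) :
    ∃ e : P ≃ₜ* completion (GrpCat.of (FreeGroup (ULift.{u} ι))),
      ∀ i, e (x i) = etaFn (GrpCat.of (FreeGroup (ULift.{u} ι))) (FreeGroup.of (ULift.up i)) := by
  have h' : IsFreeProfiniteOn P (x ∘ (Equiv.ulift : ULift.{u} ι ≃ ι)) := h.comp_equiv Equiv.ulift
  obtain ⟨e, he⟩ := h'.exists_continuousMulEquiv_completion
  exact ⟨e, fun i => he (ULift.up i)⟩

/-- **Any two free profinite groups on `ι`-indexed families are isomorphic, compatibly with the
families** (`P, P′ : Type u` profinite, `ι` `u`-small, `IsFreeProfiniteOn P x`, `IsFreeProfiniteOn P′ x′`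
⇒ `∃ e : P ≃ₜ* P′, e (x i) = x′ i`) — both are `≃ₜ* F̂(Shrink ι)` compatibly with the generators.
(Ribes–Zalesskii, *Profinite Groups*, Prop. 3.3.2.) [cite: MochizukiEtTh2009, §1 p.12] -/
theorem IsFreeProfiniteOn.exists_continuousMulEquiv [IsTopologicalGroup P] [CompactSpace P] [T2Space P]
    [TotallyDisconnectedSpace P] {ι : Type v} [Small.{u} ι] {x : ι → P} {P' : Type u} [Group P']
    [TopologicalSpace P'] [IsTopologicalGroup P'] [CompactSpace P'] [T2Space P']
    [TotallyDisconnectedSpace P'] {x' : ι → P'} (h : IsFreeProfiniteOn P x)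
    (h' : IsFreeProfiniteOn P' x') : ∃ e : P ≃ₜ* P', ∀ i, e (x i) = x' i := by
  obtain ⟨e, he⟩ := h.exists_continuousMulEquiv_completion_shrink
  obtain ⟨e', he'⟩ := h'.exists_continuousMulEquiv_completion_shrink
  refine ⟨e.trans e'.symm, fun i => ?_⟩
  change e'.symm (e (x i)) = x' i
  rw [he i, ← he' i, ContinuousMulEquiv.symm_apply_apply]

end Literature.AnabelianGeometry.SemiGraphs

/-! ### The [EtTh] §1 guard `IsFreeProfiniteOnTwo`: `Δ_X ≃ₜ* F̂₂` -/

namespace Literature.AnabelianGeometry.EtaleTheta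

open Literature.AnabelianGeometry.SemiGraphs

/-- **"`Δ_X` is a profinite free group on 2 generators" means `Δ_X ≃ₜ* F̂₂`**: a topological group
`P : Type` satisfying the L2 guard `IsFreeProfiniteOnTwo P` ([EtTh] p. 12; `Setting.lean`, the field
`IsEtThOrigin.deltaHat_free`) is isomorphic, as a topological group, to the profinite completion of the
free group on `Fin 2`, by an isomorphism carrying SOME free pair `(a, b)` of `P` to `(η x₀, η x₁)` —
`isFreeProfiniteOnTwo_iff` (abc-iut-L2-t8) + `IsFreeProfiniteOn.exists_continuousMulEquiv_completion`.
Converse direction (the completion satisfies the guard): `isFreeProfiniteOnTwo_profiniteCompletion_freeGroup`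
(abc-iut-w5-d218). (Ribes–Zalesskii, *Profinite Groups*, Prop. 3.3.2.) [cite: MochizukiEtTh2009, §1 p.12] -/
theorem IsFreeProfiniteOnTwo.exists_continuousMulEquiv_completion {P : Type} [Group P]
    [TopologicalSpace P] [IsTopologicalGroup P] (h : IsFreeProfiniteOnTwo P) :
    ∃ (x : Fin 2 → P) (e : P ≃ₜ* completion (GrpCat.of (FreeGroup (Fin 2)))),
      IsFreeProfiniteOn P x ∧ ∀ i, e (x i) = etaFn (GrpCat.of (FreeGroup (Fin 2))) (FreeGroup.of i) := by
  obtain ⟨hc, ht, htd, x, hx⟩ := (isFreeProfiniteOnTwo_iff P).mp h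
  haveI := hc; haveI := ht; haveI := htd
  obtain ⟨e, he⟩ := hx.exists_continuousMulEquiv_completion
  exact ⟨x, e, hx, he⟩

/-- **Any two topological groups satisfying the [EtTh] guard `IsFreeProfiniteOnTwo` are isomorphic as
topological groups** (both are `≃ₜ* F̂₂`). [cite: MochizukiEtTh2009, §1 p.12] -/
theorem IsFreeProfiniteOnTwo.nonempty_continuousMulEquiv {P P' : Type} [Group P] [TopologicalSpace P]
    [IsTopologicalGroup P] [Group P'] [TopologicalSpace P'] [IsTopologicalGroup P']
    (h : IsFreeProfiniteOnTwo P) (h' : IsFreeProfiniteOnTwo P') : Nonempty (P ≃ₜ* P') := by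
  obtain ⟨-, e, -, -⟩ := h.exists_continuousMulEquiv_completion
  obtain ⟨-, e', -, -⟩ := h'.exists_continuousMulEquiv_completion
  exact ⟨e.trans e'.symm⟩

end Literature.AnabelianGeometry.EtaleTheta

end
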